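import Summits.ABC.ABC.Theorems.IUTThetaPilotABCExpThreeDegOne
import Summits.ABC.ABC.Theorems.IUTThetaPilotABCOfCor312PerImageSzpiroBad
import Literature.IUT.LogVolume.Corollary22PartIIUpTo
import HarnessLib

set_option linter.dupNamespace false

/-!
# Route `route-ABC-IUTThetaPilot`, crux `ThetaPartII` (stmt-ABC-19678): POLYNOMIAL abc (`c < C_ε·rad^{3+ε}`) from
# [IUTchIII] Cor. 3.12 (per image) at the Θ-data of the SZPIRO-BAD admissible RATIONAL `λ` ALONE

Proof-only companion (cell abc-iut, WAVE-3 discharge seat abc-iut-c312-d1, gen 7; row «P-CRUX-SUFFICIENCY», part D;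
`--supports stmt-ABC-19678 --as helper`). Composition of two kernel facts, nothing else:

* abc-iut-S6's «d = 1 CUT» (`ThetaPartIIDegOne.abc_exp_three_of_cor312_degOne`, p445865…p446512): [IUTchIII] Cor. 3.12 (reading
  (U), `Cor22.Cor312AtDatum`) at the genuine Θ-data of the admissible RATIONAL points of the `λ`-line (`P ∈ UP`, `P.degree ≤ 1`,
  `l` prime `≥ 5`, `AdmitsCore`, (P2), (P5), (P6)) implies `c < C_ε·rad(abc)^{3+ε}` for every abc triple — no [GenEll] Thm. 2.1, no
  compactly bounded subset, no slot residue (`d_mod = 1`);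
* this seat's sufficiency (`Cor22.cor312PerImageAtDatum_of_szpiroSix`, p446147; [IUTchIV] Thm. 1.10 Steps (ii)/(v) lower window of
  abc-iut-w6-d018/S4): at `d_mod = 1` the per-image crux `Cor22.Cor312PerImageAtDatum P l` — hence the (U) one, `cor312AtDatum_of_perImage`
  — is a THEOREM whenever `log q^{∤2l}(λ) ≤ (6l(l+1)/((l+4)(l−3)))·(log-diff(λ) + (1 − 1/l)·log 𝔣^{∤2l}(λ)) + (6l(l+5)/((l+4)(l−3)))·log π`.

Hence (`cor312_degOne_of_perImage_szpiroBad`, **`abc_exp_three_of_cor312PerImage_szpiroBad_degOne`**): **polynomial abc with exponent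
`3 + ε` follows from [IUTchIII] Cor. 3.12, read per image, at the Θ-data of those admissible rational `λ` whose `q`-parameter VIOLATES the
Szpiro-type bound above** (constant `6l(l+1)/((l+4)(l−3)) ↓ 6`; `log-diff(λ) = 0` for rational `λ`). READING (no side): on the rational line
the IUT route's polynomial-abc output draws on the disputed inequality ONLY at points of Szpiro ratio `≳ 6(1 − O(1/l))` — the abc locus
itself; at every other admissible rational point the disputed inequality (as typed, per image) holds in the kernel. Nothing here asserts
Cor. 3.12, `ThetaPartII` or abc. [claim: Mochizuki2012, status: disputed] [cite: Mochizuki2012, IUTchIII Cor. 3.12 p. 173–174;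
IUTchIV Thm. 1.10 p. 22–23, Cor. 2.2 (ii) proof p. 46]
-/

noncomputable section

namespace Summit.ABC.ABC.Theorems.ThetaPartIIDegOne

open Literature.IUT.LogVolume Literature.IUT.LogVolume.Cor22
open Literature.NumberTheory.DiophantineGeometry Literature.NumberTheory.DiophantineGeometry.GenEll

/-- **Cor. 3.12 (reading (U)) at the admissible rational points from its per-image form at the SZPIRO-BAD ones**: for `P ∈ UP` of
degree `≤ 1` (`d_mod = 1`, `Cor22.dmod_eq_one_of_degree_le_one`), a prime `l ≥ 5` and the admissibility conditions, either
`log q^{∤2l}(λ) ≤ (6l(l+1)/((l+4)(l−3)))·(log-diff + (1 − 1/l)·log-cond^{∤2l}) + (6l(l+5)/((l+4)(l−3)))·log π` — then the per-image crux is a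
theorem (`cor312PerImageAtDatum_of_szpiroSix`, p446147) — or the point is Szpiro-bad and the hypothesis applies; (P) ⟹ (U) by
`Cor22.cor312AtDatum_of_perImage`. [claim: Mochizuki2012, status: disputed] [cite: Mochizuki2012, IUTchIII Cor. 3.12 p. 173–174] -/
theorem cor312_degOne_of_perImage_szpiroBad
    (hbad : ∀ P : NFPoint, P ∈ UP → P.degree ≤ 1 → ∀ l : ℕ, l.Prime → 5 ≤ l →
      Cor22.AdmitsCore P → Cor22.CondP2 P l → Cor22.CondP5 P l → Cor22.CondP6 P l →
      6 * l * ((l : ℝ) + 1) / (((l : ℝ) + 4) * ((l : ℝ) - 3))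
            * (P.logDiff + (1 - 1 / (l : ℝ)) * Cor22.logCondAvoid P {2, l})
          + 6 * l * ((l : ℝ) + 5) / (((l : ℝ) + 4) * ((l : ℝ) - 3)) * Real.log Real.pi <
        Cor22.logQAvoid P {2, l} →
      Cor22.Cor312PerImageAtDatum P l) :
    ∀ P : NFPoint, P ∈ UP → P.degree ≤ 1 → ∀ l : ℕ, l.Prime → 5 ≤ l →
      Cor22.AdmitsCore P → Cor22.CondP2 P l → Cor22.CondP5 P l → Cor22.CondP6 P l →
        Cor22.Cor312AtDatum P l := by
  intro P hP hdeg l hl h5 hc h2 h5' h6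
  have hd : Cor22.dmod P = 1 := Cor22.dmod_eq_one_of_degree_le_one hdeg
  refine Cor22.cor312AtDatum_of_perImage ?_
  by_cases hq : Cor22.logQAvoid P {2, l} ≤
      6 * l * ((l : ℝ) + 1) / (((l : ℝ) + 4) * ((l : ℝ) - 3))
          * (P.logDiff + (1 - 1 / (l : ℝ)) * Cor22.logCondAvoid P {2, l})
        + 6 * l * ((l : ℝ) + 5) / (((l : ℝ) + 4) * ((l : ℝ) - 3)) * Real.log Real.pi
  · exact Cor22.cor312PerImageAtDatum_of_szpiroSix hP.1 h5 hd hq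
  · exact hbad P hP hdeg l hl h5 hc h2 h5' h6 (lt_of_not_ge hq)

/-- **POLYNOMIAL abc FROM [IUTchIII] Cor. 3.12 (PER IMAGE) AT THE SZPIRO-BAD ADMISSIBLE RATIONAL `λ` ALONE**: if the per-image crux
`Cor22.Cor312PerImageAtDatum P l` holds at every admissible rational `λ`-line point (`P ∈ UP`, degree `≤ 1`, `l` prime `≥ 5`, `AdmitsCore`,
(P2), (P5), (P6)) with `log q^{∤2l}(λ) > (6l(l+1)/((l+4)(l−3)))·(log-diff(λ) + (1 − 1/l)·log 𝔣^{∤2l}(λ)) + (6l(l+5)/((l+4)(l−3)))·log π`, then for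
every `ε > 0` there is `C > 0` with `c < C·rad(abc)^{3+ε}` for every abc triple (abc-iut-S6's `abc_exp_three_of_cor312_degOne` ∘
`cor312_degOne_of_perImage_szpiroBad`). CONDITIONAL on the displayed hypothesis; nothing here asserts abc or Cor. 3.12.
[claim: Mochizuki2012, status: disputed] [cite: Mochizuki2012, IUTchIII Cor. 3.12 p. 173–174; IUTchIV Thm. A, Cor. 2.2 (ii) p. 41–46] -/
theorem abc_exp_three_of_cor312PerImage_szpiroBad_degOne
    (hbad : ∀ P : NFPoint, P ∈ UP → P.degree ≤ 1 → ∀ l : ℕ, l.Prime → 5 ≤ l →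
      Cor22.AdmitsCore P → Cor22.CondP2 P l → Cor22.CondP5 P l → Cor22.CondP6 P l →
      6 * l * ((l : ℝ) + 1) / (((l : ℝ) + 4) * ((l : ℝ) - 3))
            * (P.logDiff + (1 - 1 / (l : ℝ)) * Cor22.logCondAvoid P {2, l})
          + 6 * l * ((l : ℝ) + 5) / (((l : ℝ) + 4) * ((l : ℝ) - 3)) * Real.log Real.pi <
        Cor22.logQAvoid P {2, l} →
      Cor22.Cor312PerImageAtDatum P l)
    {ε : ℝ} (hε : 0 < ε) :
    ∃ C : ℝ, 0 < C ∧ ∀ a b c : ℕ, IsABCTriple a b c →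
      (c : ℝ) < C * ((rad a b c : ℕ) : ℝ) ^ (3 + ε) :=
  abc_exp_three_of_cor312_degOne (cor312_degOne_of_perImage_szpiroBad hbad) hε

end Summit.ABC.ABC.Theorems.ThetaPartIIDegOne

end
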